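import Literature.NumberTheory.Transcendental.ZilberFieldHomogeneityProofs
import Literature.FieldTheory.Kummer.DivisionSequencesProofs
import HarnessLib

/-!
# Discharge of `BaysKirby2018_saturation_of_isStronglyExpAlgClosed` (Bays–Kirby 2018, Lemma 8.3)

The named fact `Literature.NumberTheory.Transcendental.BaysKirby2018_saturation_of_isStronglyExpAlgClosed`
(`ZilberFieldHomogeneity.lean`; Bays–Kirby 2018, Lemma 8.3 over the base `ℚτ`: `ℵ₀`-saturation of
Zilber fields for strong exponentially-algebraic extensions) was reduced in
`ZilberFieldHomogeneityProofs.lean`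
(`BaysKirby2018_saturation_of_isStronglyExpAlgClosed_of_divisionSequences_determined`) to the
Kummer-theoretic fact `Literature.FieldTheory.Kummer.BaysKirby2018_divisionSequences_determined`
(Bays–Kirby 2018, Prop. 3.22/3.24), which is proved in
`Literature/FieldTheory/Kummer/DivisionSequencesProofs.lean`. This file records the resulting
unconditional theorem.

## References

* M. Bays, J. Kirby, *Pseudo-exponential maps, variants, and quasiminimality*, Algebra & Number
  Theory 12 (2018) 493–549, Lemma 8.3, Prop. 3.22, Prop. 3.24.
-/

namespace Literature.NumberTheory.Transcendental

universe u

/-- **`ℵ₀`-saturation for strong exponentially-algebraic extensions** (Bays–Kirby 2018,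
Lemma 8.3, base `ℚτ`): the named fact `BaysKirby2018_saturation_of_isStronglyExpAlgClosed` holds.
[cite: BaysKirby2018ANT, Lemma 8.3 (with Prop. 3.22 and Prop. 3.24)] -/
theorem BaysKirby2018_saturation_of_isStronglyExpAlgClosed_holds :
    BaysKirby2018_saturation_of_isStronglyExpAlgClosed.{u} :=
  BaysKirby2018_saturation_of_isStronglyExpAlgClosed_of_divisionSequences_determined
    Literature.FieldTheory.Kummer.BaysKirby2018_divisionSequences_determined_holds

end Literature.NumberTheory.Transcendental
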